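import Summits.Ventures.QEC.Census.BB.A1s_n168_k18_7144a1e2.CoverZ1
import Summits.Ventures.QEC.Census.BB.A1s_n168_k18_7144a1e2.CoverZ2
import Summits.Ventures.QEC.Census.BB.A1s_n168_k18_7144a1e2.CoverZ3
import Summits.Ventures.QEC.Census.BB.A1s_n168_k18_7144a1e2.CoverZ4
import HarnessLib

/-!
# Census row `A1s_n168_k18_7144a1e2` (`[[168,18,8]]`): the LABEL COVER — glue file: `coverAll : CoverSpan … 1 (2^18)` from the 11 chunk theorems
# `covZ_0 … covZ_10` of `CoverZ1 … CoverZ4.lean` (`CoverSpan.append`); input of `coverAutTab2_hcover` in `Distance.lean` (qec-search-10 g4)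
-/

namespace Summit.Ventures.QEC.Census.A1s_n168_k18_7144a1e2

open Summit.Ventures.QEC.Census

/-- **All 262143 nonzero labels are covered** (chunks glued; the range ends `1 + … = 2^18 = 2^|LZ|`). -/
theorem coverAll : CoverSpan 4 21 A1s_n168_k18_7144a1e2.bzAutData.LX A1s_n168_k18_7144a1e2.bzAutData.LZ A1s_n168_k18_7144a1e2.taus A1s_n168_k18_7144a1e2.bzAutData.sideZ.blocks 1 (2 ^ A1s_n168_k18_7144a1e2.bzAutData.LZ.length) := by
  exact (CoverSpan.append (CoverSpan.append (CoverSpan.append (CoverSpan.append (CoverSpan.append (CoverSpan.append (CoverSpan.append (CoverSpan.append (CoverSpan.append (CoverSpan.append (coverSpan_of_tabWitOK A1s_n168_k18_7144a1e2.cols_ok A1s_n168_k18_7144a1e2.Ws_ok A1s_n168_k18_7144a1e2.covZ_0) (coverSpan_of_tabWitOK A1s_n168_k18_7144a1e2.cols_ok A1s_n168_k18_7144a1e2.Ws_ok A1s_n168_k18_7144a1e2.covZ_1)) (coverSpan_of_tabWitOK A1s_n168_k18_7144a1e2.cols_ok A1s_n168_k18_7144a1e2.Ws_ok A1s_n168_k18_7144a1e2.covZ_2))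 (coverSpan_of_tabWitOK A1s_n168_k18_7144a1e2.cols_ok A1s_n168_k18_7144a1e2.Ws_ok A1s_n168_k18_7144a1e2.covZ_3)) (coverSpan_of_tabWitOK A1s_n168_k18_7144a1e2.cols_ok A1s_n168_k18_7144a1e2.Ws_ok A1s_n168_k18_7144a1e2.covZ_4)) (coverSpan_of_tabWitOK A1s_n168_k18_7144a1e2.cols_ok A1s_n168_k18_7144a1e2.Ws_ok A1s_n168_k18_7144a1e2.covZ_5)) (coverSpan_of_tabWitOK A1s_n168_k18_7144a1e2.cols_ok A1s_n168_k18_7144a1e2.Ws_ok A1s_n168_k18_7144a1e2.covZ_6)) (coverSpan_of_tabWitOK A1s_n168_k18_7144a1e2.cols_ok A1s_n168_k18_7144a1e2.Ws_ok A1s_n168_k18_7144a1e2.covZ_7)) (coverSpan_of_tabWitOK A1s_n168_k18_7144a1e2.cols_ok A1s_n168_k18_7144a1e2.Ws_ok A1s_n168_k18_7144a1e2.covZ_8)) (coverSpan_of_tabWitOK A1s_n168_k18_7144a1e2.cols_ok A1s_n168_k18_7144a1e2.Ws_ok A1s_n168_k18_7144a1e2.covZ_9)) (coverSpan_of_tabWitOK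 A1s_n168_k18_7144a1e2.cols_ok A1s_n168_k18_7144a1e2.Ws_ok A1s_n168_k18_7144a1e2.covZ_10))

end Summit.Ventures.QEC.Census.A1s_n168_k18_7144a1e2
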